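import Literature.Analysis.FluidPDE.PressureSpaceTimeTools
import Literature.Analysis.FluidPDE.PressureGreenEstimate
import HarnessLib

/-!
# The decay estimate for the mollified pressure (Seregin–Šverák 2009, (as13), before the limit)

Analysis/FluidPDE support file on the decomposition path of the named fact
`Literature.Analysis.FluidPDE.SereginSverak2009.PressureDecay` (G. Seregin, V. Šverák, Comm. PDE
34 (2009) = arXiv:0804.1803, proof of Lemma 3.5, (as13), arXiv p. 10: "the decay estimate for
the pressure field `D(z_b, ϱ; q) ≤ c[(ϱ/r) D(z_b, r; q) + (r/ϱ)² C(z_b, r; v)]`. Here … `0 < ϱ ≤ r`").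
The paper states (as13) without proof; the standard proof (Seregin, *Lecture notes on regularity
theory for the Navier–Stokes equations* (2014), proof of Lemma 6.4, pp. 97–98) splits the
pressure on `B(r)` into `q₁`, `Δq₁ = -div div(𝟙 v ⊗ v)`, bounded in `L^{3/2}` by `‖v‖²_{L³}`
(Calderón–Zygmund), and a harmonic `q₂` estimated by the mean value theorem.

Let `(u, p)` be a distributional Navier–Stokes solution (accepted
`Fluid.IsDistributionalNSSolutionOn`, force `0`, any viscosity) on the parabolic cylinder
`Q' = Q((t₀, x₀), r) = ]t₀ - r², t₀[ × 𝒞(x₀, r)` of Seregin–Šverák with `u`, `|u|²`, `p` integrable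
there, let `0 < ϱ ≤ r/4`, and mollify in space–time with a normalised bump `k = φ.normed` of
radius `ρ = φ.rOut ≤ min(r/4, r²/2)`: `P = k ⋆ 𝟙_{Q'} p`, `Tᵢⱼ = k ⋆ 𝟙_{Q'}(uᵢuⱼ)`. This file proves

  `∫_{t₀-ϱ²}^{t₀-ρ} ∫_{𝒞(x₀,ϱ)} |P|^{3/2} ≤ √2 A^{3/2} ∫∫_{Q'} |p|^{3/2} + √2 · 27 · C^{3/2} ∫∫_{Q'} |u|³`

(`SereginSverak2009.setLIntegral_mollified_pressure_rpow_le`), where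
`A = |𝒞(x₀,ϱ)|^{2/3} M |B̄_{r/2}|^{1/3}` with `M ≥ sup|λ_{r/4,r/2}|` (so `A^{3/2} = O((ϱ/r)³)` by
the scaling of `λ`, cf. `exists_nnnorm_newtonFarLaplacian_half_le`) and `C` is any constant in
the Calderón–Zygmund bound for the Hessian of the truncated Newtonian potential at radii
`(r/4, r/2)` — the conclusion of `stein1970_hessian_Lp_bound.hessian_newtonNearPotential_half`
(Stein 1970, III §1.3 Prop. 3), a HYPOTHESIS here. The steps: on each slice `τ ∈ ]t₀-ϱ², t₀-ρ[`
the mollified pressure equation `ΔP(τ) = -Σ∂ⱼ∂ᵢTᵢⱼ(τ)` holds on the `r/2`-neighbourhood of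
`𝒞(x₀, ϱ)` (`laplacian_mollified_pressure` + `closedBall_subset_parCyl_of_mem`), whence
`‖1_{𝒞(x₀,ϱ)} P(τ)‖_{3/2} ≤ A ‖P(τ)‖_{3/2} + C Σ‖Tᵢⱼ(τ)‖_{3/2}`
(`eLpNorm_indicator_le_of_laplacian_eq`); raise to the power `3/2`, integrate in `τ`, and use
Tonelli and Young (`∫ ‖P(τ)‖^{3/2}_{3/2} dτ ≤ ∫∫_{Q'}|p|^{3/2}`, `∫‖Tᵢⱼ(τ)‖^{3/2}_{3/2} ≤ ∫∫_{Q'}|u|³`).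
The limit `ρ → 0` and the assembly of (as13) are in the sequel.

## References

* G. Seregin, V. Šverák, Comm. PDE 34 (2009) 171–201 = arXiv:0804.1803, proof of Lemma 3.5,
  (as13) (arXiv p. 10). [`SereginSverak2009`]
* G. Seregin, *Lecture notes on regularity theory for the Navier–Stokes equations*, World
  Scientific (2014), Lemma 6.4 and its proof, (6.1.38)–(6.1.43), pp. 97–98. [`Seregin2014`]
* E. M. Stein, *Singular integrals and differentiability properties of functions* (1970), Ch. III
  §1.3, Prop. 3. [`Stein1971`]
-/

noncomputable section

open MeasureTheory TopologicalSpace Set Function Filter Topology Metric ContinuousLinearMap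
  InnerProductSpace
open scoped ENNReal NNReal Convolution Laplacian RealInnerProductSpace ContDiff

namespace Literature.Analysis.FluidPDE

/-- Local notation for physical space `ℝ³ = EuclideanSpace ℝ (Fin 3)`. -/
local notation "ℝ³" => EuclideanSpace ℝ (Fin 3)

-- Lebesgue measure on space–time `ℝ × ℝ³` is an additive Haar measure: the tree's instance
-- (`FluidPDE/SpaceTimeMollifier`), activated locally.
attribute [local instance] instIsAddHaarMeasureVolumeSpaceTime

namespace SereginSverak2009

variable {u : ℝ → ℝ³ → ℝ³} {p : ℝ → ℝ³ → ℝ} {ν t₀ : ℝ} {x₀ : ℝ³} {r ϱ : ℝ}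

/-- `1 ≤ 3/2` in `ℝ`. [folklore] -/
private theorem one_le_three_halves_real : (1 : ℝ) ≤ 3 / 2 := by norm_num

/-- The parabolic cylinders are bounded. [folklore] -/
theorem isBounded_parCyl (z₀ : ℝ × ℝ³) (R : ℝ) : Bornology.IsBounded (parCyl z₀ R) := by
  rw [parCyl_eq_prod]
  exact (isBounded_Ioo _ _).prod ((isBounded_ball).subset (spaceCyl_subset_ball _ _))

/-- The arithmetic of raising the slice estimate to the power `3/2`:
`L ≤ AX + C Σᵢⱼ eᵢⱼ` implies `L^{3/2} ≤ √2 (A^{3/2}X^{3/2} + 9^{1/2} C^{3/2} Σ eᵢⱼ^{3/2})`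
(`(a+b)^{3/2} ≤ √2(a^{3/2}+b^{3/2})`, `(Σ₉ c)^{3/2} ≤ 9^{1/2} Σ c^{3/2}`). [folklore] -/
theorem rpow_three_halves_le_of_le_add_mul_sum {L A X C : ℝ≥0∞} {e : Fin 3 → Fin 3 → ℝ≥0∞}
    (h : L ≤ A * X + C * ∑ i, ∑ j, e i j) :
    L ^ (3 / 2 : ℝ) ≤ (2 : ℝ≥0∞) ^ (1 / 2 : ℝ) * (A ^ (3 / 2 : ℝ) * X ^ (3 / 2 : ℝ) +
      ((9 : ℝ≥0∞) ^ (1 / 2 : ℝ) * C ^ (3 / 2 : ℝ)) *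
        ∑ q : Fin 3 × Fin 3, e q.1 q.2 ^ (3 / 2 : ℝ)) := by
  have hsum : ∑ i, ∑ j, e i j = ∑ q : Fin 3 × Fin 3, e q.1 q.2 := (Fintype.sum_prod_type' e).symm
  rw [hsum] at h
  refine (ENNReal.rpow_le_rpow h (by norm_num)).trans ?_
  refine (ENNReal.rpow_add_le_mul_rpow_add_rpow _ _ one_le_three_halves_real).trans ?_
  rw [show (3 / 2 : ℝ) - 1 = 1 / 2 by norm_num]
  refine mul_le_mul_right (add_le_add (le_of_eq (ENNReal.mul_rpow_of_nonneg _ _ (by norm_num))) ?_) _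
  rw [ENNReal.mul_rpow_of_nonneg _ _ (by norm_num)]
  have h9 := ENNReal.rpow_sum_le_const_mul_sum_rpow (Finset.univ : Finset (Fin 3 × Fin 3))
    (fun q => e q.1 q.2) one_le_three_halves_real
  rw [Finset.card_univ, Fintype.card_prod, Fintype.card_fin,
    show (3 / 2 : ℝ) - 1 = 1 / 2 by norm_num] at h9
  calc C ^ (3 / 2 : ℝ) * (∑ q : Fin 3 × Fin 3, e q.1 q.2) ^ (3 / 2 : ℝ)
      ≤ C ^ (3 / 2 : ℝ) * (((3 * 3 : ℕ) : ℝ≥0∞) ^ (1 / 2 : ℝ) *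
          ∑ q : Fin 3 × Fin 3, e q.1 q.2 ^ (3 / 2 : ℝ)) := by gcongr
    _ = (9 : ℝ≥0∞) ^ (1 / 2 : ℝ) * C ^ (3 / 2 : ℝ) *
          ∑ q : Fin 3 × Fin 3, e q.1 q.2 ^ (3 / 2 : ℝ) := by push_cast; ring

/-- **The slice estimate.** In the setting of the module docstring, for every time
`τ ∈ ]t₀ - ϱ², t₀ - ρ[` the mollified pressure satisfies
`‖1_{𝒞(x₀,ϱ)} P(τ)‖_{3/2} ≤ A ‖P(τ)‖_{3/2} + C Σᵢⱼ ‖Tᵢⱼ(τ)‖_{3/2}`,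
`A = |𝒞(x₀,ϱ)|^{2/3} M |B̄_{r/2}|^{1/3}`: the mollified pressure equation holds on the
`r/2`-neighbourhood of `𝒞(x₀, ϱ)` at time `τ` (room for the kernel,
`closedBall_subset_parCyl_of_mem`), and `eLpNorm_indicator_le_of_laplacian_eq` applies.
[cite: Seregin2014, Lemma 6.4 (proof) pp. 97–98] -/
theorem eLpNorm_indicator_mollified_pressure_le (hr : 0 < r) (hϱr : ϱ ≤ r / 4)
    (h : IsDistributionalNSSolutionOn (parCylOpens ((t₀, x₀) : ℝ × ℝ³) r) ν 0 u p)
    (hu : IntegrableOn (uncurry u) (parCyl ((t₀, x₀) : ℝ × ℝ³) r) volume)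
    (hu2 : IntegrableOn (fun z => ‖uncurry u z‖ ^ 2) (parCyl ((t₀, x₀) : ℝ × ℝ³) r) volume)
    (hp : IntegrableOn (uncurry p) (parCyl ((t₀, x₀) : ℝ × ℝ³) r) volume)
    (φ : ContDiffBump (0 : ℝ × ℝ³)) (hφ1 : φ.rOut ≤ r / 4) (hφ2 : φ.rOut ≤ r ^ 2 / 2)
    {M : ℝ≥0} (hM : ∀ z, ‖newtonFarLaplacian (r / 2 / 2) (r / 2) z‖₊ ≤ M) {C : ℝ≥0∞}
    (hCZ : ∀ g : ℝ³ → ℝ, ContDiff ℝ 2 g → HasCompactSupport g → ∀ a' c' : ℝ³, ‖a'‖ ≤ 1 →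
      ‖c'‖ ≤ 1 → eLpNorm (fun x => fderiv ℝ (fun y => fderiv ℝ
        (newtonNearPotential (r / 2 / 2) (r / 2) g) y a') x c') (3 / 2) volume ≤
          C * eLpNorm g (3 / 2) volume)
    {τ : ℝ} (hτ : τ ∈ Ioo (t₀ - ϱ ^ 2) (t₀ - φ.rOut)) :
    eLpNorm ((spaceCyl x₀ ϱ).indicator
        (stMollify (φ.normed volume) (zeroExt (parCylOpens ((t₀, x₀) : ℝ × ℝ³) r) p) τ))
        (3 / 2) volume ≤
      (volume (spaceCyl x₀ ϱ) ^ (2 / 3 : ℝ) *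
          (M * volume (closedBall (0 : ℝ³) (r / 2)) ^ (1 / 3 : ℝ))) *
          eLpNorm (stMollify (φ.normed volume)
            (zeroExt (parCylOpens ((t₀, x₀) : ℝ × ℝ³) r) p) τ) (3 / 2) volume +
        C * ∑ i, ∑ j, eLpNorm (stMollify (φ.normed volume)
          (zeroExt (parCylOpens ((t₀, x₀) : ℝ × ℝ³) r) fun t x =>
            ⟪u t x, EuclideanSpace.basisFun (Fin 3) ℝ i⟫ *
              ⟪u t x, EuclideanSpace.basisFun (Fin 3) ℝ j⟫) τ) (3 / 2) volume := by
  -- the kernel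
  have hk : ContDiff ℝ ∞ (φ.normed volume) := φ.contDiff_normed
  have hkc : HasCompactSupport (φ.normed (volume : Measure (ℝ × ℝ³))) := φ.hasCompactSupport_normed
  have hkr : ∀ w, w ∉ closedBall (0 : ℝ × ℝ³) φ.rOut → φ.normed volume w = 0 := fun w hw => by
    have hw' : w ∉ tsupport (φ.normed (volume : Measure (ℝ × ℝ³))) := by
      rwa [φ.tsupport_normed_eq]
    exact image_eq_zero_of_notMem_tsupport hw'
  -- the zero extensions and their mollifications
  have hPloc : LocallyIntegrable (zeroExt (parCylOpens ((t₀, x₀) : ℝ × ℝ³) r) p) volume :=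
    locallyIntegrable_zeroExt hp
  have hTloc : ∀ i j, LocallyIntegrable (zeroExt (parCylOpens ((t₀, x₀) : ℝ × ℝ³) r) fun t x =>
      ⟪u t x, EuclideanSpace.basisFun (Fin 3) ℝ i⟫ * ⟪u t x, EuclideanSpace.basisFun (Fin 3) ℝ j⟫)
        volume := fun i j =>
    locallyIntegrable_zeroExt (integrableOn_inner_mul_inner
      (Q := parCylOpens ((t₀, x₀) : ℝ × ℝ³) r) hu hu2 _ _)
  have hP2 : ContDiff ℝ 2 (stMollify (φ.normed volume)
      (zeroExt (parCylOpens ((t₀, x₀) : ℝ × ℝ³) r) p) τ) :=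
    (contDiff_stMollify_slice hk hkc hPloc τ).of_le two_le_infty
  have hT2 : ∀ i j, ContDiff ℝ 2 (stMollify (φ.normed volume)
      (zeroExt (parCylOpens ((t₀, x₀) : ℝ × ℝ³) r) fun t x =>
        ⟪u t x, EuclideanSpace.basisFun (Fin 3) ℝ i⟫ * ⟪u t x, EuclideanSpace.basisFun (Fin 3) ℝ j⟫) τ) :=
    fun i j => (contDiff_stMollify_slice hk hkc (hTloc i j) τ).of_le two_le_infty
  have hTc : ∀ i j, HasCompactSupport (stMollify (φ.normed volume)
      (zeroExt (parCylOpens ((t₀, x₀) : ℝ × ℝ³) r) fun t x =>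
        ⟪u t x, EuclideanSpace.basisFun (Fin 3) ℝ i⟫ * ⟪u t x, EuclideanSpace.basisFun (Fin 3) ℝ j⟫) τ) :=
    fun i j => hasCompactSupport_stMollify_zeroExt_slice (isBounded_parCyl _ _) hkc _ τ
  have hb1 : ∀ i, ‖EuclideanSpace.basisFun (Fin 3) ℝ i‖ ≤ 1 := fun i =>
    ((EuclideanSpace.basisFun (Fin 3) ℝ).orthonormal.1 i).le
  -- the mollified pressure equation on the `r/2`-neighbourhood of `𝒞(x₀, ϱ)`
  have hEq : ∀ x ∈ spaceCyl x₀ ϱ, ∀ z : ℝ³, ‖z‖ ≤ r / 2 →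
      (Δ (stMollify (φ.normed volume) (zeroExt (parCylOpens ((t₀, x₀) : ℝ × ℝ³) r) p) τ)) (x - z) =
        -∑ i, ∑ j, fderiv ℝ (fun w => fderiv ℝ (stMollify (φ.normed volume)
          (zeroExt (parCylOpens ((t₀, x₀) : ℝ × ℝ³) r) fun t x =>
            ⟪u t x, EuclideanSpace.basisFun (Fin 3) ℝ i⟫ *
              ⟪u t x, EuclideanSpace.basisFun (Fin 3) ℝ j⟫) τ) w
            (EuclideanSpace.basisFun (Fin 3) ℝ i)) (x - z) (EuclideanSpace.basisFun (Fin 3) ℝ j) := by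
    intro x hx z hz
    have hball : closedBall ((τ, x - z) : ℝ × ℝ³) φ.rOut ⊆ parCylOpens ((t₀, x₀) : ℝ × ℝ³) r :=
      closedBall_subset_parCyl_of_mem hr hϱr φ.rOut_pos hφ1 hφ2 hτ hx hz
    exact h.laplacian_mollified_pressure hu hu2 hp hk hkr hball (EuclideanSpace.basisFun (Fin 3) ℝ)
  have key := eLpNorm_indicator_le_of_laplacian_eq hP2 hT2 hTc hb1 (isOpen_spaceCyl x₀ ϱ).measurableSet
    (half_pos hr) hEq hM hCZ
  simpa only [mul_assoc] using key

/-- **Integration in time of a slice bound** (the measure-theoretic step). Let `P` and `Tᵢⱼ` be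
continuous space–time fields, `I` a measurable set of times, `S` a measurable set in space, and
suppose the slice bound `‖1_S P(τ)‖_{3/2} ≤ A ‖P(τ)‖_{3/2} + C Σᵢⱼ ‖Tᵢⱼ(τ)‖_{3/2}` for `τ ∈ I`.
Then `∫_{I×S} |P|^{3/2} ≤ √2 A^{3/2} ∫∫ |P|^{3/2} + √2 · 9^{1/2} · C^{3/2} Σᵢⱼ ∫∫ |Tᵢⱼ|^{3/2}`
(raise to the power `3/2`, `lintegral_prod_le`, Tonelli for the slice norms). [folklore] -/
theorem setLIntegral_prod_rpow_le_of_slice_bound {P : ℝ → ℝ³ → ℝ} (hPc : Continuous (uncurry P))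
    {T : Fin 3 → Fin 3 → ℝ → ℝ³ → ℝ} (hTc : ∀ i j, Continuous (uncurry (T i j)))
    {I : Set ℝ} (hI : MeasurableSet I) {S : Set ℝ³} (hS : MeasurableSet S) {A C : ℝ≥0∞}
    (hslice : ∀ τ ∈ I, eLpNorm (S.indicator (P τ)) (3 / 2) volume ≤
      A * eLpNorm (P τ) (3 / 2) volume + C * ∑ i, ∑ j, eLpNorm (T i j τ) (3 / 2) volume) :
    ∫⁻ w in I ×ˢ S, ‖P w.1 w.2‖ₑ ^ (3 / 2 : ℝ) ≤
      (2 : ℝ≥0∞) ^ (1 / 2 : ℝ) * A ^ (3 / 2 : ℝ) * (∫⁻ w, ‖uncurry P w‖ₑ ^ (3 / 2 : ℝ)) +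
        (2 : ℝ≥0∞) ^ (1 / 2 : ℝ) * ((9 : ℝ≥0∞) ^ (1 / 2 : ℝ) * C ^ (3 / 2 : ℝ)) *
          ∑ q : Fin 3 × Fin 3, (∫⁻ w, ‖uncurry (T q.1 q.2) w‖ₑ ^ (3 / 2 : ℝ)) := by
  -- Step 1: the slice estimate, raised to the power `3/2`
  have hslice' : ∀ τ ∈ I, ∫⁻ x in S, ‖P τ x‖ₑ ^ (3 / 2 : ℝ) ≤
      (2 : ℝ≥0∞) ^ (1 / 2 : ℝ) * (A ^ (3 / 2 : ℝ) * eLpNorm (P τ) (3 / 2) volume ^ (3 / 2 : ℝ) +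
        ((9 : ℝ≥0∞) ^ (1 / 2 : ℝ) * C ^ (3 / 2 : ℝ)) *
          ∑ q : Fin 3 × Fin 3, eLpNorm (T q.1 q.2 τ) (3 / 2) volume ^ (3 / 2 : ℝ)) := by
    intro τ hτ
    have h2 : ∫⁻ x in S, ‖P τ x‖ₑ ^ (3 / 2 : ℝ) =
        eLpNorm (S.indicator (P τ)) (3 / 2) volume ^ (3 / 2 : ℝ) := by
      rw [eLpNorm_indicator_eq_eLpNorm_restrict hS, eLpNorm_three_halves_rpow_eq_lintegral]
    rw [h2]
    -- (elaborate the arithmetic lemma on the hypothesis first: its sum pattern is not higher-order)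
    have h3 := rpow_three_halves_le_of_le_add_mul_sum (hslice τ hτ)
    exact h3
  -- Step 2: product integral ≤ iterated integral
  have hprod : ∫⁻ w in I ×ˢ S, ‖P w.1 w.2‖ₑ ^ (3 / 2 : ℝ) ≤
      ∫⁻ τ in I, ∫⁻ x in S, ‖P τ x‖ₑ ^ (3 / 2 : ℝ) := by
    rw [Measure.volume_eq_prod, ← Measure.prod_restrict]
    exact lintegral_prod_le _
  -- Step 3: Tonelli for the slice norms
  have hPb : ∫⁻ τ in I, eLpNorm (P τ) (3 / 2) volume ^ (3 / 2 : ℝ) ≤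
      ∫⁻ w, ‖uncurry P w‖ₑ ^ (3 / 2 : ℝ) :=
    setLIntegral_eLpNorm_slice_rpow_le hPc.aestronglyMeasurable I
  have hTb : ∀ q : Fin 3 × Fin 3, ∫⁻ τ in I, eLpNorm (T q.1 q.2 τ) (3 / 2) volume ^ (3 / 2 : ℝ) ≤
      ∫⁻ w, ‖uncurry (T q.1 q.2) w‖ₑ ^ (3 / 2 : ℝ) := fun q =>
    setLIntegral_eLpNorm_slice_rpow_le (hTc q.1 q.2).aestronglyMeasurable I
  -- Step 4: measurability of the slice-norm functions of time
  have hmP : AEMeasurable (fun τ => eLpNorm (P τ) (3 / 2) volume ^ (3 / 2 : ℝ))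
      (volume.restrict I) := by
    have : (fun τ => eLpNorm (P τ) (3 / 2) volume ^ (3 / 2 : ℝ)) =
        fun τ => ∫⁻ x, ‖uncurry P (τ, x)‖ₑ ^ (3 / 2 : ℝ) := by
      funext τ; exact eLpNorm_three_halves_rpow_eq_lintegral volume (P τ)
    rw [this]
    exact ((hPc.measurable.enorm.pow_const _).lintegral_prod_right').aemeasurable
  have hmT : ∀ q : Fin 3 × Fin 3, AEMeasurable
      (fun τ => eLpNorm (T q.1 q.2 τ) (3 / 2) volume ^ (3 / 2 : ℝ)) (volume.restrict I) := by
    intro q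
    have : (fun τ => eLpNorm (T q.1 q.2 τ) (3 / 2) volume ^ (3 / 2 : ℝ)) =
        fun τ => ∫⁻ x, ‖uncurry (T q.1 q.2) (τ, x)‖ₑ ^ (3 / 2 : ℝ) := by
      funext τ; exact eLpNorm_three_halves_rpow_eq_lintegral volume (T q.1 q.2 τ)
    rw [this]
    exact (((hTc q.1 q.2).measurable.enorm.pow_const _).lintegral_prod_right').aemeasurable
  have hmS : AEMeasurable (fun τ => ∑ q : Fin 3 × Fin 3,
      eLpNorm (T q.1 q.2 τ) (3 / 2) volume ^ (3 / 2 : ℝ)) (volume.restrict I) :=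
    Finset.aemeasurable_fun_sum _ fun q _ => hmT q
  have hm2 : AEMeasurable (fun τ => A ^ (3 / 2 : ℝ) * eLpNorm (P τ) (3 / 2) volume ^ (3 / 2 : ℝ))
      (volume.restrict I) := hmP.const_mul _
  have hm1 : AEMeasurable (fun τ => A ^ (3 / 2 : ℝ) * eLpNorm (P τ) (3 / 2) volume ^ (3 / 2 : ℝ) +
      ((9 : ℝ≥0∞) ^ (1 / 2 : ℝ) * C ^ (3 / 2 : ℝ)) *
        ∑ q : Fin 3 × Fin 3, eLpNorm (T q.1 q.2 τ) (3 / 2) volume ^ (3 / 2 : ℝ))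
      (volume.restrict I) := hm2.add (hmS.const_mul _)
  -- Step 5: split the time integral of the bound
  have hsplit : ∫⁻ τ in I, (2 : ℝ≥0∞) ^ (1 / 2 : ℝ) *
      (A ^ (3 / 2 : ℝ) * eLpNorm (P τ) (3 / 2) volume ^ (3 / 2 : ℝ) +
        ((9 : ℝ≥0∞) ^ (1 / 2 : ℝ) * C ^ (3 / 2 : ℝ)) *
          ∑ q : Fin 3 × Fin 3, eLpNorm (T q.1 q.2 τ) (3 / 2) volume ^ (3 / 2 : ℝ)) =
      (2 : ℝ≥0∞) ^ (1 / 2 : ℝ) *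
        (A ^ (3 / 2 : ℝ) * (∫⁻ τ in I, eLpNorm (P τ) (3 / 2) volume ^ (3 / 2 : ℝ)) +
          ((9 : ℝ≥0∞) ^ (1 / 2 : ℝ) * C ^ (3 / 2 : ℝ)) *
            ∑ q : Fin 3 × Fin 3, (∫⁻ τ in I, eLpNorm (T q.1 q.2 τ) (3 / 2) volume ^ (3 / 2 : ℝ))) := by
    rw [lintegral_const_mul'' _ hm1, lintegral_add_left' hm2, lintegral_const_mul'' _ hmP,
      lintegral_const_mul'' _ hmS, lintegral_finsetSum' _ fun q _ => hmT q]
  -- Step 6: combine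
  calc ∫⁻ w in I ×ˢ S, ‖P w.1 w.2‖ₑ ^ (3 / 2 : ℝ)
      ≤ ∫⁻ τ in I, ∫⁻ x in S, ‖P τ x‖ₑ ^ (3 / 2 : ℝ) := hprod
    _ ≤ ∫⁻ τ in I, (2 : ℝ≥0∞) ^ (1 / 2 : ℝ) * (A ^ (3 / 2 : ℝ) * eLpNorm (P τ) (3 / 2) volume ^ (3 / 2 : ℝ) +
        ((9 : ℝ≥0∞) ^ (1 / 2 : ℝ) * C ^ (3 / 2 : ℝ)) *
          ∑ q : Fin 3 × Fin 3, eLpNorm (T q.1 q.2 τ) (3 / 2) volume ^ (3 / 2 : ℝ)) :=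
        setLIntegral_mono' hI hslice'
    _ = (2 : ℝ≥0∞) ^ (1 / 2 : ℝ) *
        (A ^ (3 / 2 : ℝ) * (∫⁻ τ in I, eLpNorm (P τ) (3 / 2) volume ^ (3 / 2 : ℝ)) +
          ((9 : ℝ≥0∞) ^ (1 / 2 : ℝ) * C ^ (3 / 2 : ℝ)) *
            ∑ q : Fin 3 × Fin 3, (∫⁻ τ in I, eLpNorm (T q.1 q.2 τ) (3 / 2) volume ^ (3 / 2 : ℝ))) :=
        hsplit
    _ ≤ (2 : ℝ≥0∞) ^ (1 / 2 : ℝ) *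
        (A ^ (3 / 2 : ℝ) * (∫⁻ w, ‖uncurry P w‖ₑ ^ (3 / 2 : ℝ)) +
          ((9 : ℝ≥0∞) ^ (1 / 2 : ℝ) * C ^ (3 / 2 : ℝ)) *
            ∑ q : Fin 3 × Fin 3, (∫⁻ w, ‖uncurry (T q.1 q.2) w‖ₑ ^ (3 / 2 : ℝ))) :=
        mul_le_mul_right (add_le_add (mul_le_mul_right hPb _)
          (mul_le_mul_right (Finset.sum_le_sum fun q _ => hTb q) _)) _
    _ = _ := by ring

/-- **The decay estimate for the mollified pressure, before the limit.** In the setting of the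
module docstring (`0 < ϱ ≤ r/4`, kernel radius `ρ ≤ min(r/4, r²/2)`),
`∫_{t₀-ϱ²}^{t₀-ρ} ∫_{𝒞(x₀,ϱ)} |P|^{3/2} ≤ √2 A^{3/2} ∫∫_{Q'} |p|^{3/2} + √2 · 9^{1/2} · 9 · C^{3/2} ∫∫_{Q'} |u|³`
with `A = |𝒞(x₀,ϱ)|^{2/3} M |B̄_{r/2}|^{1/3}`: the slice estimate raised to the power `3/2` and
integrated in time (`setLIntegral_prod_rpow_le_of_slice_bound`), with Young's inequality for the
mollifications of `𝟙_{Q'} p` and `𝟙_{Q'} uᵢuⱼ` (`|uᵢuⱼ|^{3/2} ≤ |u|³`). This is the body of the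
proof of (as13) (Seregin–Šverák 2009, p. 10; Seregin 2014, proof of Lemma 6.4) for the
regularised pressure. [cite: SereginSverak2009, proof of Lemma 3.5, (as13)] -/
theorem setLIntegral_mollified_pressure_rpow_le (hr : 0 < r) (hϱr : ϱ ≤ r / 4)
    (h : IsDistributionalNSSolutionOn (parCylOpens ((t₀, x₀) : ℝ × ℝ³) r) ν 0 u p)
    (hu : IntegrableOn (uncurry u) (parCyl ((t₀, x₀) : ℝ × ℝ³) r) volume)
    (hu2 : IntegrableOn (fun z => ‖uncurry u z‖ ^ 2) (parCyl ((t₀, x₀) : ℝ × ℝ³) r) volume)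
    (hp : IntegrableOn (uncurry p) (parCyl ((t₀, x₀) : ℝ × ℝ³) r) volume)
    (φ : ContDiffBump (0 : ℝ × ℝ³)) (hφ1 : φ.rOut ≤ r / 4) (hφ2 : φ.rOut ≤ r ^ 2 / 2)
    {M : ℝ≥0} (hM : ∀ z, ‖newtonFarLaplacian (r / 2 / 2) (r / 2) z‖₊ ≤ M) {C : ℝ≥0∞}
    (hCZ : ∀ g : ℝ³ → ℝ, ContDiff ℝ 2 g → HasCompactSupport g → ∀ a' c' : ℝ³, ‖a'‖ ≤ 1 →
      ‖c'‖ ≤ 1 → eLpNorm (fun x => fderiv ℝ (fun y => fderiv ℝ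
        (newtonNearPotential (r / 2 / 2) (r / 2) g) y a') x c') (3 / 2) volume ≤
          C * eLpNorm g (3 / 2) volume) :
    ∫⁻ w in Ioo (t₀ - ϱ ^ 2) (t₀ - φ.rOut) ×ˢ spaceCyl x₀ ϱ,
        ‖stMollify (φ.normed volume) (zeroExt (parCylOpens ((t₀, x₀) : ℝ × ℝ³) r) p) w.1 w.2‖ₑ ^
          (3 / 2 : ℝ) ≤
      (2 : ℝ≥0∞) ^ (1 / 2 : ℝ) *
          (volume (spaceCyl x₀ ϱ) ^ (2 / 3 : ℝ) *
            (M * volume (closedBall (0 : ℝ³) (r / 2)) ^ (1 / 3 : ℝ))) ^ (3 / 2 : ℝ) *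
          (∫⁻ w in parCyl ((t₀, x₀) : ℝ × ℝ³) r, ‖p w.1 w.2‖ₑ ^ (3 / 2 : ℝ)) +
        (2 : ℝ≥0∞) ^ (1 / 2 : ℝ) * ((9 : ℝ≥0∞) ^ (1 / 2 : ℝ) * 9) * C ^ (3 / 2 : ℝ) *
          (∫⁻ w in parCyl ((t₀, x₀) : ℝ × ℝ³) r, ‖u w.1 w.2‖ₑ ^ (3 : ℕ)) := by
  have hk : ContDiff ℝ ∞ (φ.normed volume) := φ.contDiff_normed
  have hkc : HasCompactSupport (φ.normed (volume : Measure (ℝ × ℝ³))) := φ.hasCompactSupport_normed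
  have hPloc : LocallyIntegrable (zeroExt (parCylOpens ((t₀, x₀) : ℝ × ℝ³) r) p) volume :=
    locallyIntegrable_zeroExt hp
  have hTint : ∀ i j, IntegrableOn (uncurry fun t x =>
      ⟪u t x, EuclideanSpace.basisFun (Fin 3) ℝ i⟫ * ⟪u t x, EuclideanSpace.basisFun (Fin 3) ℝ j⟫)
        (parCylOpens ((t₀, x₀) : ℝ × ℝ³) r : Set (ℝ × ℝ³)) volume := fun i j =>
    integrableOn_inner_mul_inner (Q := parCylOpens ((t₀, x₀) : ℝ × ℝ³) r) hu hu2 _ _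
  have hTloc : ∀ i j, LocallyIntegrable (zeroExt (parCylOpens ((t₀, x₀) : ℝ × ℝ³) r) fun t x =>
      ⟪u t x, EuclideanSpace.basisFun (Fin 3) ℝ i⟫ * ⟪u t x, EuclideanSpace.basisFun (Fin 3) ℝ j⟫)
        volume := fun i j => locallyIntegrable_zeroExt (hTint i j)
  have hPc : Continuous (uncurry (stMollify (φ.normed volume)
      (zeroExt (parCylOpens ((t₀, x₀) : ℝ × ℝ³) r) p))) :=
    (contDiff_uncurry_stMollify hk hkc hPloc).continuous
  have hTc : ∀ i j, Continuous (uncurry (stMollify (φ.normed volume)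
      (zeroExt (parCylOpens ((t₀, x₀) : ℝ × ℝ³) r) fun t x =>
        ⟪u t x, EuclideanSpace.basisFun (Fin 3) ℝ i⟫ * ⟪u t x, EuclideanSpace.basisFun (Fin 3) ℝ j⟫))) :=
    fun i j => (contDiff_uncurry_stMollify hk hkc (hTloc i j)).continuous
  have hb1 : ∀ i, ‖EuclideanSpace.basisFun (Fin 3) ℝ i‖ ≤ 1 := fun i =>
    ((EuclideanSpace.basisFun (Fin 3) ℝ).orthonormal.1 i).le
  -- the slice bound, integrated
  have hint := setLIntegral_prod_rpow_le_of_slice_bound hPc hTc measurableSet_Ioo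
    (isOpen_spaceCyl x₀ ϱ).measurableSet
    (fun τ hτ => eLpNorm_indicator_mollified_pressure_le hr hϱr h hu hu2 hp φ hφ1 hφ2 hM hCZ hτ)
  refine hint.trans ?_
  -- Young's inequality for the two mollified zero extensions
  have hPY : ∫⁻ w, ‖uncurry (stMollify (φ.normed volume)
      (zeroExt (parCylOpens ((t₀, x₀) : ℝ × ℝ³) r) p)) w‖ₑ ^ (3 / 2 : ℝ) ≤
      ∫⁻ w in parCyl ((t₀, x₀) : ℝ × ℝ³) r, ‖p w.1 w.2‖ₑ ^ (3 / 2 : ℝ) := by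
    rw [uncurry_stMollify]
    exact lintegral_rpow_normed_convolution_zeroExt_le φ hp.aestronglyMeasurable
  have hTY : ∀ q : Fin 3 × Fin 3, ∫⁻ w, ‖uncurry (stMollify (φ.normed volume)
      (zeroExt (parCylOpens ((t₀, x₀) : ℝ × ℝ³) r) fun t x =>
        ⟪u t x, EuclideanSpace.basisFun (Fin 3) ℝ q.1⟫ *
          ⟪u t x, EuclideanSpace.basisFun (Fin 3) ℝ q.2⟫)) w‖ₑ ^ (3 / 2 : ℝ) ≤
      ∫⁻ w in parCyl ((t₀, x₀) : ℝ × ℝ³) r, ‖u w.1 w.2‖ₑ ^ (3 : ℕ) := by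
    intro q
    rw [uncurry_stMollify]
    refine (lintegral_rpow_normed_convolution_zeroExt_le φ (hTint q.1 q.2).aestronglyMeasurable).trans ?_
    exact lintegral_mono fun w => enorm_inner_mul_inner_rpow_le _ _ _ (hb1 q.1) (hb1 q.2)
  have hsum : ∑ q : Fin 3 × Fin 3, (∫⁻ w, ‖uncurry (stMollify (φ.normed volume)
      (zeroExt (parCylOpens ((t₀, x₀) : ℝ × ℝ³) r) fun t x =>
        ⟪u t x, EuclideanSpace.basisFun (Fin 3) ℝ q.1⟫ *
          ⟪u t x, EuclideanSpace.basisFun (Fin 3) ℝ q.2⟫)) w‖ₑ ^ (3 / 2 : ℝ)) ≤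
      (9 : ℝ≥0∞) * ∫⁻ w in parCyl ((t₀, x₀) : ℝ × ℝ³) r, ‖u w.1 w.2‖ₑ ^ (3 : ℕ) := by
    refine (Finset.sum_le_sum fun q _ => hTY q).trans_eq ?_
    rw [Finset.sum_const, Finset.card_univ, Fintype.card_prod, Fintype.card_fin, nsmul_eq_mul]
    push_cast
    ring
  calc (2 : ℝ≥0∞) ^ (1 / 2 : ℝ) *
        (volume (spaceCyl x₀ ϱ) ^ (2 / 3 : ℝ) *
          (M * volume (closedBall (0 : ℝ³) (r / 2)) ^ (1 / 3 : ℝ))) ^ (3 / 2 : ℝ) *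
        (∫⁻ w, ‖uncurry (stMollify (φ.normed volume)
          (zeroExt (parCylOpens ((t₀, x₀) : ℝ × ℝ³) r) p)) w‖ₑ ^ (3 / 2 : ℝ)) +
      (2 : ℝ≥0∞) ^ (1 / 2 : ℝ) * ((9 : ℝ≥0∞) ^ (1 / 2 : ℝ) * C ^ (3 / 2 : ℝ)) *
        ∑ q : Fin 3 × Fin 3, (∫⁻ w, ‖uncurry (stMollify (φ.normed volume)
          (zeroExt (parCylOpens ((t₀, x₀) : ℝ × ℝ³) r) fun t x =>
            ⟪u t x, EuclideanSpace.basisFun (Fin 3) ℝ q.1⟫ *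
              ⟪u t x, EuclideanSpace.basisFun (Fin 3) ℝ q.2⟫)) w‖ₑ ^ (3 / 2 : ℝ))
      ≤ (2 : ℝ≥0∞) ^ (1 / 2 : ℝ) *
        (volume (spaceCyl x₀ ϱ) ^ (2 / 3 : ℝ) *
          (M * volume (closedBall (0 : ℝ³) (r / 2)) ^ (1 / 3 : ℝ))) ^ (3 / 2 : ℝ) *
        (∫⁻ w in parCyl ((t₀, x₀) : ℝ × ℝ³) r, ‖p w.1 w.2‖ₑ ^ (3 / 2 : ℝ)) +
      (2 : ℝ≥0∞) ^ (1 / 2 : ℝ) * ((9 : ℝ≥0∞) ^ (1 / 2 : ℝ) * C ^ (3 / 2 : ℝ)) *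
        ((9 : ℝ≥0∞) * ∫⁻ w in parCyl ((t₀, x₀) : ℝ × ℝ³) r, ‖u w.1 w.2‖ₑ ^ (3 : ℕ)) :=
        add_le_add (mul_le_mul_right hPY _) (mul_le_mul_right hsum _)
    _ = _ := by ring

end SereginSverak2009

end Literature.Analysis.FluidPDE

end
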